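import Summits.QuantumFields.BalabanUV.Beta.EriceRemainderEnclosureHistoryAutonomyComparisonAgeCompositionKeyFree

/-!
# EriceRemainderEnclosureHistoryAutonomyComparisonAgeCompositionReadVariation — (E115d) route (N), first order, ABSTRACT: THE TAIL VARIATION OF AN OLD READ OF A
# NON-NEGATIVE INPUT IS AT MOST FOUR FIRST ENTRIES TIMES ITS MASS.  For a TAIL-SUM kernel `K m l = Σ_{l<k<A} w k m` (the aggregate of lone kernels: age `k` reads
# the lags `l < k` with the weight `w k m ≥ 0`, NON-INCREASING in the row `m` — along a flow `w k m = L_kh_{m+k}³∕2`) and a non-negative input `r` vanishing beyond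
# the horizon: `Σ_{m ≥ n} |R r m − R r (m+1)| ≤ 4·(Σ_k w k n)·Σ_{c > n} r c` (**`var_read_le`**) — the variation of the read below a pin is controlled by the FIRST
# ENTRY `F(n) = Σ_k w k n` of the kernel at the pin (NOT its row mass `Σ_k k·w k n`) times the mass of the input below the pin.  With (E115c)
# `sol_ge_first_sub_var` this makes the Neumann remainder of the KEY-free composition explicit kernel data (**`sol_ge_first_sub_reads`**):
#     `ε n ≥ S_y(S_O e) n − 4·F_O(n)·(Σ_{c>n} (R_y ε) c) ∕ (1 − ρ)`,
# and `Σ_{c>n} (R_y ε) c ≤ Σ_{c>n} x̃_y(c)` (the young total mass below the pin) as soon as `0 ≤ ε ≤ 1` below the pin (the row induction) — README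
# `HOME/b2b-balaban-beta-d4-p2/g96/README.md` §3 (R2); measured sizes §4 (G): `F_O = 10⁻⁴…0.09`, young total mass `≈ 1.2–1.7` for the age one.

Cell `pub-balaban`, β-function sub-cell, BINDER row D4 «RemainderConst leaves for Bałaban's split» (`HOME/BINDER-OWNERS.md`; owner lineage `b2b-balaban-beta-an4`;
this file by co-owner #2 lineage `b2b-balaban-beta-d4-p2`, generation 96), β-FLOW TEAM duty (1), FREEZE (0) honoured (def-free; imports (E115c); uses (E115c)
`sol_ge_first_sub_var` BY NAME; pure renewal algebra; nothing restated).

HONEST FRAMING (page 1, verbatim and binding).  *"Discharging BetaPertH makes Bałaban's UV stability UNCONDITIONAL — a real constructive-QFT result; it is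
NOT the continuum limit and NOT the Clay problem."*  THIS FILE DISCHARGES NOTHING OF THE KIND.  Elementary linear algebra about ABSTRACT real sequences and
triangular systems — tools for the cell's own first-order census (route (N) of conjecture (E58′)); the form, signs, ages and moments of Bałaban's (1.22) limit
functional are NOT PRINTED ([I] p. 298; GAPS G-t4-U2-1∕-2) and NOT asserted.  Row D4 class UNCHANGED (critical-path width 0; instance 0∕1; D4 DISCHARGE NO
DATE).  HONEST DEPENDENCY: continuum YM on T⁴ ⇐ BetaPertH ∧ nine spine estimates (0/9 proved); BetaPertH ⇐ (D1) ∧ (D4) ∧ CAP+tail; G-an2-4 gates asym, D1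
and NE2/3/4.

NOT CLAIMED: the flow bound of the young total mass; (R1) of README §6; the END beyond the tree's classes; anything printed — NOT B12 Thm 2, NOT BetaPertH.

WHAT IS PROVED ([folklore]; 0 `def`, 0 sorry; (E71a)'s conventions).  §1 `sum_tail_eq_sum_indicator`, **`read_eq_sum_ages`** (a tail-sum read = Σ over the ages of
weight × window sum), `window_succ`, `shifted_sum_le`, `telescope_Ico`.  §2 **`var_weighted_window_le`** (one age: `≤ 4·w k n·mass`), **`var_read_le`**.
§3 **`sol_ge_first_sub_reads`**.
-/
noncomputable section
open Finset

namespace Summit.QuantumFields.BalabanUV.Beta.EriceRemainderEnclosureHistoryAutonomyComparisonAgeCompositionReadVariation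

open Summit.QuantumFields.BalabanUV.Beta.EriceRemainderEnclosureHistoryAutonomyComparisonAgeCompositionKeyFree (sol_ge_first_sub_var)

variable {A N : ℕ} {w : ℕ → ℕ → ℝ} {K : ℕ → ℕ → ℝ} {R : (ℕ → ℝ) → ℕ → ℝ}

/-! ## §1 A tail-sum read is a sum over the ages of weight × window sum -/

/-- `Σ_{k ∈ (l, A)} g k = Σ_{k ∈ [1, A)} [l < k]·g k`. [folklore] -/
theorem sum_tail_eq_sum_indicator (g : ℕ → ℝ) (l : ℕ) :
    ∑ k ∈ Ico (l + 1) A, g k = ∑ k ∈ Ico 1 A, (if l < k then g k else 0) := by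
  rw [← sum_filter]
  congr 1
  ext k
  simp only [mem_Ico, mem_filter]
  omega

/-- **THE READ BY AGES.**  For the tail-sum kernel `K m l = Σ_{k∈(l,A)} w k m`:  `R r m = Σ_{k∈[1,A)} w k m · Σ_{l < min k N} r (m+1+l)`. [folklore] -/
theorem read_eq_sum_ages (hR : ∀ v m, R v m = ∑ l ∈ range N, K m l * v (m + 1 + l)) (hK : ∀ m l, K m l = ∑ k ∈ Ico (l + 1) A, w k m)
    (r : ℕ → ℝ) (m : ℕ) : R r m = ∑ k ∈ Ico 1 A, w k m * ∑ l ∈ range (min k N), r (m + 1 + l) := by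
  have hset : ∀ k, range (min k N) = (range N).filter (· < k) := fun k => by
    ext l; simp only [mem_range, mem_filter, lt_min_iff]; tauto
  calc R r m = ∑ l ∈ range N, K m l * r (m + 1 + l) := hR r m
    _ = ∑ l ∈ range N, ∑ k ∈ Ico 1 A, (if l < k then w k m * r (m + 1 + l) else 0) :=
        sum_congr rfl fun l _ => by
          rw [hK, sum_tail_eq_sum_indicator, sum_mul]
          exact sum_congr rfl fun k _ => by split_ifs <;> simp
    _ = ∑ k ∈ Ico 1 A, ∑ l ∈ range N, (if l < k then w k m * r (m + 1 + l) else 0) := sum_comm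
    _ = ∑ k ∈ Ico 1 A, w k m * ∑ l ∈ range (min k N), r (m + 1 + l) :=
        sum_congr rfl fun k _ => by
          rw [hset k, sum_filter, mul_sum]
          exact sum_congr rfl fun l _ => by split_ifs <;> simp

/-- The window sum one row deeper: `Σ_{l<κ} r (m+2+l) = Σ_{l<κ} r (m+1+l) + r (m+1+κ) − r (m+1)`. [folklore] -/
theorem window_succ (r : ℕ → ℝ) (m κ : ℕ) :
    ∑ l ∈ range κ, r (m + 1 + 1 + l) = ∑ l ∈ range κ, r (m + 1 + l) + r (m + 1 + κ) - r (m + 1) := by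
  have h := sum_range_succ' (fun l => r (m + 1 + l)) κ
  -- h : Σ_{l<κ+1} r(m+1+l) = Σ_{l<κ} r(m+1+(l+1)) + r(m+1+0)
  rw [sum_range_succ] at h
  have e : ∀ l, r (m + 1 + (l + 1)) = r (m + 1 + 1 + l) := fun l => by rw [show m + 1 + (l + 1) = m + 1 + 1 + l by ring]
  simp only [e, add_zero] at h
  linarith

/-- Shifted partial sums of a non-negative sequence vanishing beyond `N` are at most its mass below the pin. [folklore] -/
theorem shifted_sum_le {r : ℕ → ℝ} (hr0 : ∀ c, 0 ≤ r c) (hrt : ∀ c, N < c → r c = 0) {n a : ℕ} (ha : n + 1 ≤ a) (b : ℕ) :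
    ∑ c ∈ Ico a b, r c ≤ ∑ c ∈ Ico (n + 1) (N + 1), r c := by
  rw [← sum_filter_of_ne (p := fun c => c ≤ N) (fun c _ hc => by by_contra h; exact hc (hrt c (not_le.mp h)))]
  exact sum_le_sum_of_subset_of_nonneg (fun c hc => by
    rw [mem_filter, mem_Ico] at hc; rw [mem_Ico]; omega) (fun c _ _ => hr0 c)

/-- Telescoping over `[n, M]`. [folklore] -/
theorem telescope_Ico (u : ℕ → ℝ) : ∀ M n, n ≤ M + 1 → ∑ m ∈ Ico n (M + 1), (u m - u (m + 1)) = u n - u (M + 1) := by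
  intro M
  induction M with
  | zero =>
    intro n hn
    interval_cases n
    · simp
    · simp
  | succ M ih =>
    intro n hn
    by_cases h : n = M + 2
    · subst h; simp
    · rw [sum_Ico_succ_top (by omega), ih n (by omega)]; ring

/-! ## §2 The variation of a weighted window sum, and of the read -/

/-- **ONE AGE.**  `w k ·` non-negative and non-increasing in the row, `r ≥ 0` vanishing beyond `N`, `W m = Σ_{l<κ} r (m+1+l)`; then
`Σ_{m∈[n,N]} |w k m·W m − w k (m+1)·W (m+1)| ≤ 4·w k n·Σ_{c∈(n,N]} r c` (Abel summation: the decay part telescopes against `w k n·W n`, the shift part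
moves `r (m+1)` out and `r (m+1+κ)` in). [folklore] -/
theorem var_weighted_window_le (hw0 : ∀ k m, 0 ≤ w k m) (hwmono : ∀ k m, w k (m + 1) ≤ w k m)
    {r : ℕ → ℝ} (hr0 : ∀ c, 0 ≤ r c) (hrt : ∀ c, N < c → r c = 0) (k κ n : ℕ) :
    ∑ m ∈ Ico n (N + 1), |w k m * ∑ l ∈ range κ, r (m + 1 + l) - w k (m + 1) * ∑ l ∈ range κ, r (m + 1 + 1 + l)|
      ≤ 4 * w k n * ∑ c ∈ Ico (n + 1) (N + 1), r c := by
  set Rs : ℝ := ∑ c ∈ Ico (n + 1) (N + 1), r c with hRs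
  set W : ℕ → ℝ := fun m => ∑ l ∈ range κ, r (m + 1 + l) with hW
  have hW0 : ∀ m, 0 ≤ W m := fun m => sum_nonneg fun l _ => hr0 _
  have hWsucc : ∀ m, W (m + 1) = W m + r (m + 1 + κ) - r (m + 1) := fun m => by simp only [hW]; exact window_succ r m κ
  have hwn : ∀ m, n ≤ m → w k m ≤ w k n := by
    intro m hm
    induction m, hm using Nat.le_induction with
    | base => exact le_rfl
    | succ m _ ih => exact (hwmono k m).trans ih
  have hRs0 : 0 ≤ Rs := sum_nonneg fun c _ => hr0 c
  -- W m ≤ Rs for m ≥ n (a shifted partial sum)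
  have hWle : ∀ m, n ≤ m → W m ≤ Rs := fun m hm => by
    simp only [hW]
    have e : ∑ l ∈ range κ, r (m + 1 + l) = ∑ c ∈ Ico (m + 1) (m + 1 + κ), r c := by
      rw [sum_Ico_eq_sum_range]; simp
    rw [e]; exact shifted_sum_le hr0 hrt (by omega) _
  -- pointwise: |u m − u (m+1)| ≤ (w m − w(m+1))·W m + w (m+1)·(r (m+1) + r (m+1+κ))
  have hpt : ∀ m, |w k m * W m - w k (m + 1) * W (m + 1)| ≤ (w k m * W m - w k (m + 1) * W (m + 1)) + 2 * (w k (m + 1) * r (m + 1 + κ)) := by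
    intro m
    rw [hWsucc m]
    have h1 := hw0 k (m + 1); have h2 := hwmono k m; have h3 := hW0 m; have h4 := hr0 (m + 1); have h5 := hr0 (m + 1 + κ)
    have hA : 0 ≤ (w k m - w k (m + 1)) * W m := mul_nonneg (by linarith) h3
    have hB : 0 ≤ w k (m + 1) * r (m + 1) := mul_nonneg h1 h4
    have hC : 0 ≤ w k (m + 1) * r (m + 1 + κ) := mul_nonneg h1 h5
    rw [abs_le]; constructor <;> nlinarith
  -- sum the pointwise bound
  have hsum1 : ∑ m ∈ Ico n (N + 1), (w k m * W m - w k (m + 1) * W (m + 1)) ≤ w k n * Rs := by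
    by_cases hn : n ≤ N + 1
    · rw [telescope_Ico (fun m => w k m * W m) N n hn]
      have := mul_nonneg (hw0 k (N + 1)) (hW0 (N + 1))
      have := mul_le_mul_of_nonneg_left (hWle n le_rfl) (hw0 k n)
      linarith
    · rw [Ico_eq_empty (by omega), sum_empty]; exact mul_nonneg (hw0 k n) hRs0
  have hsum2 : ∑ m ∈ Ico n (N + 1), w k (m + 1) * r (m + 1 + κ) ≤ w k n * Rs := by
    calc ∑ m ∈ Ico n (N + 1), w k (m + 1) * r (m + 1 + κ) ≤ ∑ m ∈ Ico n (N + 1), w k n * r (m + 1 + κ) :=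
          sum_le_sum fun m hm => mul_le_mul_of_nonneg_right (hwn (m + 1) (by have := (mem_Ico.mp hm).1; omega)) (hr0 _)
      _ = w k n * ∑ m ∈ Ico n (N + 1), r (m + 1 + κ) := by rw [mul_sum]
      _ ≤ w k n * Rs := by
          refine mul_le_mul_of_nonneg_left ?_ (hw0 k n)
          have e : ∑ m ∈ Ico n (N + 1), r (m + 1 + κ) = ∑ c ∈ Ico (n + (1 + κ)) (N + 1 + (1 + κ)), r c := by
            rw [← sum_Ico_add' r n (N + 1) (1 + κ)]
            exact sum_congr rfl fun m _ => by rw [add_assoc]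
          rw [e]; exact shifted_sum_le hr0 hrt (by omega) _
  calc ∑ m ∈ Ico n (N + 1), |w k m * W m - w k (m + 1) * W (m + 1)|
      ≤ ∑ m ∈ Ico n (N + 1), ((w k m * W m - w k (m + 1) * W (m + 1)) + 2 * (w k (m + 1) * r (m + 1 + κ))) := sum_le_sum fun m _ => hpt m
    _ = ∑ m ∈ Ico n (N + 1), (w k m * W m - w k (m + 1) * W (m + 1)) + 2 * ∑ m ∈ Ico n (N + 1), w k (m + 1) * r (m + 1 + κ) := by
        rw [sum_add_distrib, mul_sum]
    _ ≤ w k n * Rs + 2 * (w k n * Rs) := by linarith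
    _ ≤ 4 * w k n * Rs := by nlinarith [mul_nonneg (hw0 k n) hRs0]

/-- **THE VARIATION OF AN OLD READ.**  Tail-sum kernel `K m l = Σ_{k∈(l,A)} w k m` with `w ≥ 0` non-increasing in the row; `r ≥ 0` vanishing beyond `N`.  Then
`Σ_{m∈[n,N]} |R r m − R r (m+1)| ≤ 4·(Σ_{k∈[1,A)} w k n)·Σ_{c∈(n,N]} r c` — FIRST ENTRY at the pin times the input's mass below the pin. [folklore] -/
theorem var_read_le (hR : ∀ v m, R v m = ∑ l ∈ range N, K m l * v (m + 1 + l)) (hK : ∀ m l, K m l = ∑ k ∈ Ico (l + 1) A, w k m)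
    (hw0 : ∀ k m, 0 ≤ w k m) (hwmono : ∀ k m, w k (m + 1) ≤ w k m)
    {r : ℕ → ℝ} (hr0 : ∀ c, 0 ≤ r c) (hrt : ∀ c, N < c → r c = 0) (n : ℕ) :
    ∑ m ∈ Ico n (N + 1), |R r m - R r (m + 1)| ≤ 4 * (∑ k ∈ Ico 1 A, w k n) * ∑ c ∈ Ico (n + 1) (N + 1), r c := by
  have hpt : ∀ m, |R r m - R r (m + 1)| ≤ ∑ k ∈ Ico 1 A,
      |w k m * ∑ l ∈ range (min k N), r (m + 1 + l) - w k (m + 1) * ∑ l ∈ range (min k N), r (m + 1 + 1 + l)| := by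
    intro m
    rw [read_eq_sum_ages hR hK r m, read_eq_sum_ages hR hK r (m + 1), ← sum_sub_distrib]
    exact abs_sum_le_sum_abs _ _
  calc ∑ m ∈ Ico n (N + 1), |R r m - R r (m + 1)|
      ≤ ∑ m ∈ Ico n (N + 1), ∑ k ∈ Ico 1 A, |w k m * ∑ l ∈ range (min k N), r (m + 1 + l) - w k (m + 1) * ∑ l ∈ range (min k N), r (m + 1 + 1 + l)| :=
        sum_le_sum fun m _ => hpt m
    _ = ∑ k ∈ Ico 1 A, ∑ m ∈ Ico n (N + 1), |w k m * ∑ l ∈ range (min k N), r (m + 1 + l) - w k (m + 1) * ∑ l ∈ range (min k N), r (m + 1 + 1 + l)| :=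
        sum_comm
    _ ≤ ∑ k ∈ Ico 1 A, 4 * w k n * ∑ c ∈ Ico (n + 1) (N + 1), r c := sum_le_sum fun k _ => var_weighted_window_le hw0 hwmono hr0 hrt k (min k N) n
    _ = 4 * (∑ k ∈ Ico 1 A, w k n) * ∑ c ∈ Ico (n + 1) (N + 1), r c := by rw [← sum_mul, ← mul_sum]

/-! ## §3 The KEY-free composition bound with the remainder as kernel data -/

/-- **THE KEY-FREE COMPOSITION BOUND, REMAINDER BY READS.**  In the setting of (E115c) `sol_ge_first_sub_var` with an OLD kernel of tail-sum form
`K_O m l = Σ_{k∈(l,A)} w k m` (`w ≥ 0` non-increasing in the row): if the young reads of the full surplus below the pin are non-negative (`0 ≤ R_y ε`, e.g. from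
`0 ≤ ε` below the pin), then
`ε n ≥ S_y(S_O e) n − 4·(Σ_k w k n)·(Σ_{c∈(n,N]} R_y ε c) ∕ (1 − ρ)`. [folklore] -/
theorem sol_ge_first_sub_reads {KO Ky : ℕ → ℕ → ℝ} {RO Ry SO Sy : (ℕ → ℝ) → ℕ → ℝ}
    (hRO : ∀ v n, RO v n = ∑ l ∈ range N, KO n l * v (n + 1 + l)) (hKO : ∀ m l, KO m l = ∑ k ∈ Ico (l + 1) A, w k m)
    (hw0 : ∀ k m, 0 ≤ w k m) (hwmono : ∀ k m, w k (m + 1) ≤ w k m)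
    (hRy : ∀ v n, Ry v n = ∑ l ∈ range N, Ky n l * v (n + 1 + l)) (hKy : ∀ n l, 0 ≤ Ky n l)
    (hSO : ∀ w : ℕ → ℝ, (∀ n, N < n → w n = 0) → (∀ n, N < n → SO w n = 0) ∧ ∀ n, SO w n = w n - RO (SO w) n)
    (hSy : ∀ w : ℕ → ℝ, (∀ n, N < n → w n = 0) → (∀ n, N < n → Sy w n = 0) ∧ ∀ n, Sy w n = w n - Ry (Sy w) n)
    (hENDO : ∀ J n, J ≤ N → 0 ≤ SO (fun m => if m ≤ J then (1 : ℝ) else 0) n ∧ SO (fun m => if m ≤ J then (1 : ℝ) else 0) n ≤ 1)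
    {n : ℕ} {ρ : ℝ} (hrow : ∀ m, n ≤ m → ∑ l ∈ range N, Ky m l ≤ ρ) (hρ1 : ρ < 1)
    {e : ℕ → ℝ} (he : ∀ n, N < n → e n = 0)
    {ε : ℕ → ℝ} (hεtail : ∀ n, N < n → ε n = 0) (hεrec : ∀ n, ε n = e n - RO ε n - Ry ε n) (hRy0 : ∀ c, 0 ≤ Ry ε c) :
    Sy (SO e) n - 4 * (∑ k ∈ Ico 1 A, w k n) * (∑ c ∈ Ico (n + 1) (N + 1), Ry ε c) / (1 - ρ) ≤ ε n := by
  have h1 := sol_ge_first_sub_var hRO hRy hKy hSO hSy hENDO hrow hρ1 he hεtail hεrec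
  have hRyt : ∀ c, N < c → Ry ε c = 0 := fun c hc => by
    rw [hRy]; exact sum_eq_zero fun l _ => by rw [hεtail (c + 1 + l) (by omega), mul_zero]
  have h2 := var_read_le hRO hKO hw0 hwmono hRy0 hRyt n
  have h1ρ : 0 < 1 - ρ := by linarith
  have h3 := div_le_div_of_nonneg_right h2 h1ρ.le
  rw [mul_div_assoc] at h3 ⊢
  linarith

end Summit.QuantumFields.BalabanUV.Beta.EriceRemainderEnclosureHistoryAutonomyComparisonAgeCompositionReadVariation

end
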